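import Summits.Ventures.QEC.Census.HB.HB90a.BZStructZ
import Summits.Ventures.QEC.Census.HB.HB90a.BZBoundsZ
import Summits.Ventures.QEC.Census.HB.HB90a.BZInfoSetsZ1
import Summits.Ventures.QEC.Census.HB.HB90a.BZEnumZ01
import Summits.Ventures.QEC.Census.HB.HB90a.BZEnumZ02
import Summits.Ventures.QEC.Census.HB.HB90a.BZEnumZ03
import Summits.Ventures.QEC.Census.CertCheckBZSound
import Summits.Ventures.QEC.Census.CertChunks
import HarnessLib

/-!
# `HB90a` — `bz` certificate, side Z: ASSEMBLY `d_Z = 9` (tier KERNEL (CERTIFIED); emitted by qec-search-7)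

`(cert.code _).dZ = 9` for the CSS code of the certificate (`Fin 90`, check matrices `rowMatrix 90 cert.HX/HZ`) by
type-10's `DistCert.dZ_code_of_bz` (`Census/CertCheckBZSound.lean`: structural check of the distance certificate +
`bzZStruct` + `bzZLen` + every block) with each block recombined from its KERNEL information-set facts
(`BZInfoSetsZ*`), its enumeration verdicts (`BZEnumZ*`) and its bound (`BZBoundsZ`) by
`CertBZInfoSets.bzZBlock_of_parts`.
-/

namespace Summit.Ventures.QEC.Census.HB90a

/-- Block 0 of side Z passes type-10's block check (from its parts). -/
theorem blkZ_0 : HB90a.cert.bzZBlock HB90a.bzData 0 = true :=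
  cert.bzZBlock_of_parts bzData (b := 0) (blk := bzBlockZ0) rfl rfl
    (forall_lt_append (forall_lt_append (forall_lt_zero) (forall_lt_single 0 sysZ_0_0)) (forall_lt_single 1 sysZ_0_1))
    (forall_lt_append (forall_lt_append (forall_lt_zero) (forall_lt_single 0 enumZ_0_0)) (forall_lt_single 1 enumZ_0_1))
    boundZ_0

/-- Block 1 of side Z passes type-10's block check (from its parts). -/
theorem blkZ_1 : HB90a.cert.bzZBlock HB90a.bzData 1 = true :=
  cert.bzZBlock_of_parts bzData (b := 1) (blk := bzBlockZ1) rfl rfl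
    (forall_lt_append (forall_lt_append (forall_lt_zero) (forall_lt_single 0 sysZ_1_0)) (forall_lt_single 1 sysZ_1_1))
    (forall_lt_append (forall_lt_append (forall_lt_zero) (forall_lt_single 0 enumZ_1_0)) (forall_lt_single 1 enumZ_1_1))
    boundZ_1

/-- Block 2 of side Z passes type-10's block check (from its parts). -/
theorem blkZ_2 : HB90a.cert.bzZBlock HB90a.bzData 2 = true :=
  cert.bzZBlock_of_parts bzData (b := 2) (blk := bzBlockZ2) rfl rfl
    (forall_lt_append (forall_lt_append (forall_lt_zero) (forall_lt_single 0 sysZ_2_0)) (forall_lt_single 1 sysZ_2_1))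
    (forall_lt_append (forall_lt_append (forall_lt_zero) (forall_lt_single 0 enumZ_2_0)) (forall_lt_single 1 enumZ_2_1))
    boundZ_2

set_option maxRecDepth 100000 in
/-- **`d_Z = 9` for `HB90a`** (tier KERNEL (CERTIFIED)): the CSS code of the certificate has Z-distance exactly 9. -/
theorem dZ_eq_bz : (HB90a.cert.code (HB90a.cert.commOK_of_checkStructure (by decide +kernel))).dZ = 9 :=
  HB90a.cert.dZ_code_of_bz HB90a.bzData (by decide +kernel) bzZStruct_ok bzZLen_ok
    (forall_lt_append (forall_lt_append (forall_lt_append (forall_lt_zero) (forall_lt_single 0 blkZ_0)) (forall_lt_single 1 blkZ_1)) (forall_lt_single 2 blkZ_2))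

end Summit.Ventures.QEC.Census.HB90a
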